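import Mathlib
import Summits.AtomisticToContinuum.FouriersLaw.Theses.EmbeddedDrudeMourre
import Summits.AtomisticToContinuum.FouriersLaw.Theorems.EmbeddedDrudeMourreDrudeDissolutionStubExcursionSecondDifferenceGradientDecomposition
import Literature.Analysis.Complex.MeanSquareThreeLines
import HarnessLib

/-!
# The local Morse–Bott gradient floor near a co-moving curve
# (stub B1b″ of line `kinetic-polymer-gas-on-the-time-axis`, step L3 of the gradient floor (C4))
(crux `EmbeddedDrudeMourre.DrudeDissolution`, item stmt-AtomisticToContinuum-12593; `--supports` file, closes
nothing; lead c13)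

WHAT. `gradient_floor_local_comoving`: let `Ω = σ·A·S₁·S₂` with `σ = ±1` and `A ∈ C¹` (cell order,
`S₁ p = sin((p.2.1 − p.1)/2)`, `S₂ p = sin((p.2.1 − p.2.2)/2)`). At a point `p₀` of the co-moving curve of the first
exchange plane — `S₁ p₀ = 0`, `A p₀ = 0` — which is not a triple point (`S₂ p₀ ≠ 0`) and at which `A` is
TANGENTIALLY non-degenerate (`∂A/∂(1,1,0) ≠ 0` or `∂A/∂(0,0,1) ≠ 0` at `p₀`; for the resonance function this is
`sheetFn_plane_regular`), there are `r, c > 0` with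
`c·((A p)² + (S₁ p)²) ≤ (∂₁Ω p)² + (∂₂Ω p)² + (∂₃Ω p)²` on the ball `dist p p₀ < r`.

HOW. With `aⱼ = ∂ⱼA`, `cᵢ` the half-angle cosines: `∂₂Ω − ∂₁Ω = σ(A·S₂c₁ + S₁·h)`,
`∂₁Ω + ∂₂Ω = σS₁(S₂(a₁+a₂) + Ac₂/2)`, `∂₃Ω = σS₁(S₂a₃ − Ac₂/2)` (`fderiv_factorised_apply`), and
`(∂₁Ω)² + (∂₂Ω)² = ½((∂₁Ω+∂₂Ω)² + (∂₂Ω−∂₁Ω)²)`; near `p₀`, `(S₂c₁)²` has a floor, `h` a ceiling and the two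
tangential brackets a joint floor (continuity), and the algebra `gradient_floor_local_alg` combines them.
-/

noncomputable section

open Set Real Topology Metric
open Literature.MathematicalPhysics.KineticTheory
open Literature.MathematicalPhysics.KineticTheory.PhononBoltzmann

namespace Summit.AtomisticToContinuum.FouriersLaw.Theorems.DrudeDissolution.KineticPolymerGasOnTheTimeAxis

/-! ### The algebra of the local floor -/

/-- **The algebra of the local Morse–Bott floor.** With the three partials of `Ω = σ·A·S₁·S₂` written out
(`σ² = 1`), a floor `g₀ ≤ (S₂c₁)²`, a ceiling `|S₂(a₂−a₁) + Ac₂/2| ≤ H`, a joint floor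
`κ ≤ (S₂(a₁+a₂) + Ac₂/2)² + (S₂a₃ − Ac₂/2)²` and a weight `0 < θ ≤ 1` with `2θH² ≤ κ`, one has
`(θg₀/4)·A² + (κ/4)·S₁² ≤ Σⱼ(∂ⱼΩ)²`. [folklore] -/
theorem gradient_floor_local_alg {σ A S₁ S₂ c₁ c₂ a₁ a₂ a₃ g₀ H κ θ : ℝ} (hσ : σ ^ 2 = 1)
    (hg : g₀ ≤ (S₂ * c₁) ^ 2) (hH : |S₂ * (a₂ - a₁) + A * c₂ / 2| ≤ H)
    (hκ : κ ≤ (S₂ * (a₁ + a₂) + A * c₂ / 2) ^ 2 + (S₂ * a₃ - A * c₂ / 2) ^ 2)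
    (hθ0 : 0 < θ) (hθ1 : θ ≤ 1) (hθH : 2 * θ * H ^ 2 ≤ κ) :
    θ * g₀ / 4 * A ^ 2 + κ / 4 * S₁ ^ 2 ≤
      (σ * (S₁ * S₂ * a₁ + A * S₂ * (-(c₁ / 2)) + A * S₁ * 0)) ^ 2 +
        (σ * (S₁ * S₂ * a₂ + A * S₂ * (c₁ / 2) + A * S₁ * (c₂ / 2))) ^ 2 +
        (σ * (S₁ * S₂ * a₃ + A * S₂ * 0 + A * S₁ * (-(c₂ / 2)))) ^ 2 := by
  -- remove `σ`
  have hrhs : (σ * (S₁ * S₂ * a₁ + A * S₂ * (-(c₁ / 2)) + A * S₁ * 0)) ^ 2 +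
        (σ * (S₁ * S₂ * a₂ + A * S₂ * (c₁ / 2) + A * S₁ * (c₂ / 2))) ^ 2 +
        (σ * (S₁ * S₂ * a₃ + A * S₂ * 0 + A * S₁ * (-(c₂ / 2)))) ^ 2 =
      σ ^ 2 * ((S₁ * S₂ * a₁ + A * S₂ * (-(c₁ / 2)) + A * S₁ * 0) ^ 2 +
        (S₁ * S₂ * a₂ + A * S₂ * (c₁ / 2) + A * S₁ * (c₂ / 2)) ^ 2 +
        (S₁ * S₂ * a₃ + A * S₂ * 0 + A * S₁ * (-(c₂ / 2))) ^ 2) := by ring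
  rw [hrhs, hσ, one_mul]
  -- the normal and tangential combinations
  have hD : (S₁ * S₂ * a₁ + A * S₂ * (-(c₁ / 2)) + A * S₁ * 0) ^ 2 +
        (S₁ * S₂ * a₂ + A * S₂ * (c₁ / 2) + A * S₁ * (c₂ / 2)) ^ 2 +
        (S₁ * S₂ * a₃ + A * S₂ * 0 + A * S₁ * (-(c₂ / 2))) ^ 2 =
      ((S₁ * (S₂ * (a₁ + a₂) + A * c₂ / 2)) ^ 2 +
          (A * (S₂ * c₁) + S₁ * (S₂ * (a₂ - a₁) + A * c₂ / 2)) ^ 2) / 2 +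
        (S₁ * (S₂ * a₃ - A * c₂ / 2)) ^ 2 := by ring
  rw [hD]
  -- bounds on the pieces
  have hN2 : (A * (S₂ * c₁)) ^ 2 / 2 - (S₁ * (S₂ * (a₂ - a₁) + A * c₂ / 2)) ^ 2 ≤
      (A * (S₂ * c₁) + S₁ * (S₂ * (a₂ - a₁) + A * c₂ / 2)) ^ 2 :=
    Literature.Analysis.Complex.half_sq_sub_sq_le_sq_add _ _
  have hT : κ * S₁ ^ 2 ≤ (S₁ * (S₂ * (a₁ + a₂) + A * c₂ / 2)) ^ 2 + (S₁ * (S₂ * a₃ - A * c₂ / 2)) ^ 2 := by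
    calc κ * S₁ ^ 2 ≤ ((S₂ * (a₁ + a₂) + A * c₂ / 2) ^ 2 + (S₂ * a₃ - A * c₂ / 2) ^ 2) * S₁ ^ 2 :=
          mul_le_mul_of_nonneg_right hκ (sq_nonneg _)
      _ = (S₁ * (S₂ * (a₁ + a₂) + A * c₂ / 2)) ^ 2 + (S₁ * (S₂ * a₃ - A * c₂ / 2)) ^ 2 := by ring
  have hA2 : g₀ * A ^ 2 ≤ (A * (S₂ * c₁)) ^ 2 := by
    calc g₀ * A ^ 2 ≤ (S₂ * c₁) ^ 2 * A ^ 2 := mul_le_mul_of_nonneg_right hg (sq_nonneg _)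
      _ = (A * (S₂ * c₁)) ^ 2 := by ring
  have hS2 : (S₁ * (S₂ * (a₂ - a₁) + A * c₂ / 2)) ^ 2 ≤ H ^ 2 * S₁ ^ 2 := by
    have h0 : 0 ≤ |S₂ * (a₂ - a₁) + A * c₂ / 2| := abs_nonneg _
    have h1 := pow_le_pow_left₀ h0 hH 2
    rw [sq_abs] at h1
    calc (S₁ * (S₂ * (a₂ - a₁) + A * c₂ / 2)) ^ 2 = (S₂ * (a₂ - a₁) + A * c₂ / 2) ^ 2 * S₁ ^ 2 := by ring
      _ ≤ H ^ 2 * S₁ ^ 2 := mul_le_mul_of_nonneg_right h1 (sq_nonneg _)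
  -- abbreviate the squares
  set Nsq := (A * (S₂ * c₁) + S₁ * (S₂ * (a₂ - a₁) + A * c₂ / 2)) ^ 2 with hNsq
  set T1sq := (S₁ * (S₂ * (a₁ + a₂) + A * c₂ / 2)) ^ 2 with hT1sq
  set T2sq := (S₁ * (S₂ * a₃ - A * c₂ / 2)) ^ 2 with hT2sq
  set P := (A * (S₂ * c₁)) ^ 2 with hP
  set Q := (S₁ * (S₂ * (a₂ - a₁) + A * c₂ / 2)) ^ 2 with hQ
  have hN0 : 0 ≤ Nsq := sq_nonneg _
  have hT10 : 0 ≤ T1sq := sq_nonneg _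
  have hT20 : 0 ≤ T2sq := sq_nonneg _
  -- `θ Nsq ≤ Nsq`, `θ (P/2 − Q) ≤ θ Nsq`
  have h1 : θ * (P / 2 - Q) ≤ θ * Nsq := mul_le_mul_of_nonneg_left hN2 hθ0.le
  have h2 : θ * Nsq ≤ Nsq := mul_le_of_le_one_left hN0 hθ1
  have h3 : θ * (g₀ * A ^ 2) ≤ θ * P := mul_le_mul_of_nonneg_left hA2 hθ0.le
  have h4 : θ * Q ≤ θ * (H ^ 2 * S₁ ^ 2) := mul_le_mul_of_nonneg_left hS2 hθ0.le
  have h5 : θ * (H ^ 2 * S₁ ^ 2) ≤ κ / 2 * S₁ ^ 2 := by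
    have : θ * H ^ 2 ≤ κ / 2 := by linarith
    calc θ * (H ^ 2 * S₁ ^ 2) = (θ * H ^ 2) * S₁ ^ 2 := by ring
      _ ≤ κ / 2 * S₁ ^ 2 := mul_le_mul_of_nonneg_right this (sq_nonneg _)
  linarith [h1, h2, h3, h4, h5, hT, hN0, hT10, hT20]

/-! ### Continuity helpers -/

/-- A continuous real function keeps a strict lower bound on a ball. [folklore] -/
theorem exists_ball_gt_of_continuousAt {X : Type*} [PseudoMetricSpace X] {f : X → ℝ} {x₀ : X} {m : ℝ}
    (hf : ContinuousAt f x₀) (hm : m < f x₀) : ∃ r : ℝ, 0 < r ∧ ∀ x, dist x x₀ < r → m < f x := by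
  have h := hf.eventually (lt_mem_nhds hm)
  obtain ⟨r, hr, hball⟩ := Metric.eventually_nhds_iff.1 h
  exact ⟨r, hr, fun x hx => hball hx⟩

/-- A continuous real function keeps a strict upper bound on a ball. [folklore] -/
theorem exists_ball_lt_of_continuousAt {X : Type*} [PseudoMetricSpace X] {f : X → ℝ} {x₀ : X} {M : ℝ}
    (hf : ContinuousAt f x₀) (hM : f x₀ < M) : ∃ r : ℝ, 0 < r ∧ ∀ x, dist x x₀ < r → f x < M := by
  have h := hf.eventually (gt_mem_nhds hM)
  obtain ⟨r, hr, hball⟩ := Metric.eventually_nhds_iff.1 h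
  exact ⟨r, hr, fun x hx => hball hx⟩

/-! ### The local floor -/

/-- **Registered sub-goal `gradient_floor_local_comoving` (L3 of the gradient floor): the local Morse–Bott floor
at a non-degenerate point of a co-moving curve.** Let `Ω q = σ·A q·sin((q.2.1−q.1)/2)·sin((q.2.1−q.2.2)/2)` with
`σ = ±1` and `A ∈ C¹`. If `sin((p₀.2.1−p₀.1)/2) = 0`, `A p₀ = 0`, `sin((p₀.2.1−p₀.2.2)/2) ≠ 0` and
`fderiv A p₀ (1,1,0) ≠ 0 ∨ fderiv A p₀ (0,0,1) ≠ 0`, then there are `r, c > 0` such that for `dist p p₀ < r`: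
`c·((A p)² + sin²((p.2.1−p.1)/2)) ≤ (fderiv Ω p (1,0,0))² + (fderiv Ω p (0,1,0))² + (fderiv Ω p (0,0,1))²`.
[folklore] -/
theorem gradient_floor_local_comoving :
    ∀ (Ω A : ℝ × ℝ × ℝ → ℝ) (σ : ℝ) (p₀ : ℝ × ℝ × ℝ), (σ = 1 ∨ σ = -1) → ContDiff ℝ 1 A →
      (∀ q, Ω q = σ * A q * Real.sin ((q.2.1 - q.1) / 2) * Real.sin ((q.2.1 - q.2.2) / 2)) →
      Real.sin ((p₀.2.1 - p₀.1) / 2) = 0 → A p₀ = 0 → Real.sin ((p₀.2.1 - p₀.2.2) / 2) ≠ 0 →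
      (fderiv ℝ A p₀ (1, 1, 0) ≠ 0 ∨ fderiv ℝ A p₀ (0, 0, 1) ≠ 0) →
      ∃ r c : ℝ, 0 < r ∧ 0 < c ∧ ∀ p : ℝ × ℝ × ℝ, dist p p₀ < r →
        c * ((A p) ^ 2 + Real.sin ((p.2.1 - p.1) / 2) ^ 2) ≤
          (fderiv ℝ Ω p (1, 0, 0)) ^ 2 + (fderiv ℝ Ω p (0, 1, 0)) ^ 2 + (fderiv ℝ Ω p (0, 0, 1)) ^ 2 := by
  intro Ω A σ p₀ hσ hA hΩ hS₁ hA0 hS₂ htan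
  have hσ2 : σ ^ 2 = 1 := by rcases hσ with h | h <;> rw [h] <;> norm_num
  -- continuity of the ingredients
  have hAc : Continuous A := hA.continuous
  have hAd : ∀ p, DifferentiableAt ℝ A p := fun p => (hA.differentiable one_ne_zero) p
  have hfd : Continuous fun p => fderiv ℝ A p := hA.continuous_fderiv one_ne_zero
  have ha : ∀ e : ℝ × ℝ × ℝ, Continuous fun p => fderiv ℝ A p e := fun e =>
    (ContinuousLinearMap.apply ℝ ℝ e).continuous.comp hfd
  have cS₂ : Continuous fun p : ℝ × ℝ × ℝ => Real.sin ((p.2.1 - p.2.2) / 2) := by fun_prop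
  have cc₁ : Continuous fun p : ℝ × ℝ × ℝ => Real.cos ((p.2.1 - p.1) / 2) := by fun_prop
  have cc₂ : Continuous fun p : ℝ × ℝ × ℝ => Real.cos ((p.2.1 - p.2.2) / 2) := by fun_prop
  -- the three auxiliary functions
  set g : ℝ × ℝ × ℝ → ℝ := fun p => (Real.sin ((p.2.1 - p.2.2) / 2) * Real.cos ((p.2.1 - p.1) / 2)) ^ 2 with hg
  set h : ℝ × ℝ × ℝ → ℝ := fun p => |Real.sin ((p.2.1 - p.2.2) / 2) *
      (fderiv ℝ A p (0, 1, 0) - fderiv ℝ A p (1, 0, 0)) + A p * Real.cos ((p.2.1 - p.2.2) / 2) / 2| with hh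
  set k : ℝ × ℝ × ℝ → ℝ := fun p => (Real.sin ((p.2.1 - p.2.2) / 2) * (fderiv ℝ A p (1, 0, 0) + fderiv ℝ A p (0, 1, 0)) +
      A p * Real.cos ((p.2.1 - p.2.2) / 2) / 2) ^ 2 +
    (Real.sin ((p.2.1 - p.2.2) / 2) * fderiv ℝ A p (0, 0, 1) - A p * Real.cos ((p.2.1 - p.2.2) / 2) / 2) ^ 2 with hk
  have cg : Continuous g := by rw [hg]; exact (cS₂.mul cc₁).pow 2
  have ch : Continuous h := by
    rw [hh]; exact ((cS₂.mul ((ha _).sub (ha _))).add ((hAc.mul cc₂).div_const 2)).abs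
  have ck : Continuous k := by
    rw [hk]
    exact (((cS₂.mul ((ha _).add (ha _))).add ((hAc.mul cc₂).div_const 2)).pow 2).add
      (((cS₂.mul (ha _)).sub ((hAc.mul cc₂).div_const 2)).pow 2)
  -- values at `p₀`
  have hc₁0 : Real.cos ((p₀.2.1 - p₀.1) / 2) ^ 2 = 1 := by
    have := Real.sin_sq_add_cos_sq ((p₀.2.1 - p₀.1) / 2)
    rw [hS₁] at this; linarith
  have hg0 : 0 < g p₀ := by
    have e : g p₀ = Real.sin ((p₀.2.1 - p₀.2.2) / 2) ^ 2 * Real.cos ((p₀.2.1 - p₀.1) / 2) ^ 2 := by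
      simp only [hg, mul_pow]
    rw [e, hc₁0, mul_one]
    positivity
  have hk0 : 0 < k p₀ := by
    have hadd : fderiv ℝ A p₀ (1, 0, 0) + fderiv ℝ A p₀ (0, 1, 0) = fderiv ℝ A p₀ (1, 1, 0) := by
      rw [← map_add]; norm_num
    have e : k p₀ = (Real.sin ((p₀.2.1 - p₀.2.2) / 2) * fderiv ℝ A p₀ (1, 1, 0)) ^ 2 +
        (Real.sin ((p₀.2.1 - p₀.2.2) / 2) * fderiv ℝ A p₀ (0, 0, 1)) ^ 2 := by
      simp only [hk]
      rw [hA0, ← hadd]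
      ring
    rw [e]
    rcases htan with h1 | h3
    · have : 0 < (Real.sin ((p₀.2.1 - p₀.2.2) / 2) * fderiv ℝ A p₀ (1, 1, 0)) ^ 2 := by positivity
      nlinarith [sq_nonneg (Real.sin ((p₀.2.1 - p₀.2.2) / 2) * fderiv ℝ A p₀ (0, 0, 1))]
    · have : 0 < (Real.sin ((p₀.2.1 - p₀.2.2) / 2) * fderiv ℝ A p₀ (0, 0, 1)) ^ 2 := by positivity
      nlinarith [sq_nonneg (Real.sin ((p₀.2.1 - p₀.2.2) / 2) * fderiv ℝ A p₀ (1, 1, 0))]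
  -- balls
  obtain ⟨r₁, hr₁, hb₁⟩ := exists_ball_gt_of_continuousAt cg.continuousAt (half_lt_self hg0)
  obtain ⟨r₂, hr₂, hb₂⟩ := exists_ball_lt_of_continuousAt ch.continuousAt (lt_add_one (h p₀))
  obtain ⟨r₃, hr₃, hb₃⟩ := exists_ball_gt_of_continuousAt ck.continuousAt (half_lt_self hk0)
  -- constants
  set g₀ := g p₀ / 2 with hg₀
  set H := h p₀ + 1 with hH
  set κ := k p₀ / 2 with hκ
  have hHpos : 0 < H := by rw [hH]; have : 0 ≤ h p₀ := abs_nonneg _; linarith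
  have hκpos : 0 < κ := by rw [hκ]; linarith
  set θ := min 1 (κ / (2 * H ^ 2)) with hθ
  have hθ0 : 0 < θ := by rw [hθ]; exact lt_min one_pos (by positivity)
  have hθ1 : θ ≤ 1 := min_le_left _ _
  have hθH : 2 * θ * H ^ 2 ≤ κ := by
    have : θ ≤ κ / (2 * H ^ 2) := min_le_right _ _
    have h2 : 0 < 2 * H ^ 2 := by positivity
    calc 2 * θ * H ^ 2 = θ * (2 * H ^ 2) := by ring
      _ ≤ κ / (2 * H ^ 2) * (2 * H ^ 2) := mul_le_mul_of_nonneg_right this h2.le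
      _ = κ := by field_simp
  refine ⟨min r₁ (min r₂ r₃), min (θ * g₀ / 4) (κ / 4), lt_min hr₁ (lt_min hr₂ hr₃),
    lt_min (by positivity) (by positivity), fun p hp => ?_⟩
  have hp₁ : dist p p₀ < r₁ := lt_of_lt_of_le hp (min_le_left _ _)
  have hp₂ : dist p p₀ < r₂ := lt_of_lt_of_le hp ((min_le_right _ _).trans (min_le_left _ _))
  have hp₃ : dist p p₀ < r₃ := lt_of_lt_of_le hp ((min_le_right _ _).trans (min_le_right _ _))
  -- the partials at `p`
  obtain ⟨e11, e12, e13⟩ := fderiv_S1_apply p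
  obtain ⟨e21, e22, e23⟩ := fderiv_S2_apply p
  have d1 := fderiv_factorised_apply Ω A σ p (1, 0, 0) (hAd p) hΩ
  have d2 := fderiv_factorised_apply Ω A σ p (0, 1, 0) (hAd p) hΩ
  have d3 := fderiv_factorised_apply Ω A σ p (0, 0, 1) (hAd p) hΩ
  rw [e11, e21] at d1
  rw [e12, e22] at d2
  rw [e13, e23] at d3
  rw [d1, d2, d3]
  have halg := gradient_floor_local_alg (σ := σ) (A := A p) (S₁ := Real.sin ((p.2.1 - p.1) / 2))
    (S₂ := Real.sin ((p.2.1 - p.2.2) / 2)) (c₁ := Real.cos ((p.2.1 - p.1) / 2)) (c₂ := Real.cos ((p.2.1 - p.2.2) / 2))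
    (a₁ := fderiv ℝ A p (1, 0, 0)) (a₂ := fderiv ℝ A p (0, 1, 0)) (a₃ := fderiv ℝ A p (0, 0, 1))
    (g₀ := g₀) (H := H) (κ := κ) (θ := θ) hσ2 (le_of_lt (hb₁ p hp₁)) (le_of_lt (hb₂ p hp₂))
    (le_of_lt (hb₃ p hp₃)) hθ0 hθ1 hθH
  refine le_trans ?_ halg
  have hA2 := sq_nonneg (A p)
  have hS2 := sq_nonneg (Real.sin ((p.2.1 - p.1) / 2))
  calc min (θ * g₀ / 4) (κ / 4) * (A p ^ 2 + Real.sin ((p.2.1 - p.1) / 2) ^ 2)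
      = min (θ * g₀ / 4) (κ / 4) * A p ^ 2 + min (θ * g₀ / 4) (κ / 4) * Real.sin ((p.2.1 - p.1) / 2) ^ 2 := by ring
    _ ≤ θ * g₀ / 4 * A p ^ 2 + κ / 4 * Real.sin ((p.2.1 - p.1) / 2) ^ 2 :=
        add_le_add (mul_le_mul_of_nonneg_right (min_le_left _ _) hA2)
          (mul_le_mul_of_nonneg_right (min_le_right _ _) hS2)

end Summit.AtomisticToContinuum.FouriersLaw.Theorems.DrudeDissolution.KineticPolymerGasOnTheTimeAxis

end
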